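import Summits.HubbardSuperconductivity.HubbardSuperconductivity.Theorems.LevyLogBootstrapBlock2InfDivXXZAxisLogConvex
import Summits.HubbardSuperconductivity.HubbardSuperconductivity.Theorems.LevyLogBootstrapLevyTransportKernelPositivity
import HarnessLib

/-!
# Crux `Block2InfDivXXZ` (stmt-HubbardSuperconductivity-15048, route `LevyLogBootstrap`):
# the 2×2-block kernel decays monotonically along every coarse axis (reflection positivity alone)

Sibling of `…Block2InfDivXXZAxisLogConvex.lean`. There, ground-state reflection positivity gave
log-convexity of the coarse block kernel `n ↦ k₂(n, 0)` at every centre `2 ≤ n ≤ m - 2` (`M = 2m`);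
the coarse kernel is also even, `k₂(m - n, 0) = k₂(n, 0)` (`coarseKernel_neg`), and positive. A
log-convex sequence on `{1, …, m-1}` that is symmetric about `m/2` is non-increasing up to the middle:
its logarithmic increments `d_n = log k₂(n+1,0) - log k₂(n,0)` are non-decreasing in `n` and satisfy
`d_{m-1-n} = -d_n`, so `d_n ≤ d_{m-1-n} = -d_n` for `n ≤ m/2 - 1`. Hence
(**`coarseKernel_axis_antitone(_all)`**, registered sub-goal): for every `Δ ≤ 0`, even `M ≥ 4` and
every normalised `S^z_tot = 0` sector ground state,
`k₂(n+1, 0) ≤ k₂(n, 0)` for `1 ≤ n`, `n + 1 ≤ m/2` — MONOTONE DECAY OF THE BLOCK TRANSVERSE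
CORRELATIONS ALONG THE AXIS from one block up to a quarter of the torus, unconditionally. (Together with
`k₂(X) ≤ k₂(0)`, Cauchy–Schwarz, this is the full shape information reflection positivity provides on
an axis; the crux's residual content is local, see the evidence notes on the item.)
Kennedy–Lieb–Shastry (1988) / Dyson–Lieb–Simon (1978) (reflection positivity); the monotonicity
consequence is folklore for reflection-positive states. No definition is introduced; sorry-free.
-/

noncomputable section

set_option linter.dupNamespace false

namespace Summit.HubbardSuperconductivity.HubbardSuperconductivity.Theorems.LevyLogBootstrap

open scoped BigOperators Matrix ComplexOrder ComplexConjugate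
open Matrix Finset Complex
open Literature.MathematicalPhysics.QuantumLattice Literature.Probability.LatticeModels
open Literature.Analysis.Matrix

section Monotone

variable (M : ℕ) {m : ℕ} [NeZero M] [NeZero m]

/-- Positivity of the coarse block kernel on the axis for every real `Δ` (even `M ≥ 4`), from the
all-`Δ` Perron–Frobenius positivity `transverseKernelPos_allDelta`. [folklore] -/
theorem coarseKernel_axis_pos_allDelta (hEven : Even M) (h4 : 4 ≤ M) (Δ : ℝ)
    (ψ : TensorIndex (TorusSite 2 M) 2 → ℂ)
    (hψ : ψ ∈ @spinZSector (TorusSite 2 M) _ _ 1 0) (hnorm : star ψ ⬝ᵥ ψ = 1)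
    (heig : Matrix.mulVec (xxzHamiltonian 1 (torusGraph 2 M) (-1) Δ) ψ =
      ((lowestEnergyInSector 1 (xxzHamiltonian 1 (torusGraph 2 M) (-1) Δ) 0 : ℝ) : ℂ) • ψ)
    (hM : M = 2 * m) (a : ZMod m) :
    0 < ∑ x' : TorusSite 2 M, ∑ y' : TorusSite 2 M,
      if (∀ i : Fin 2, (x' i).val / 2 = ((![a, 0] : TorusSite 2 m) i).val) ∧
          (∀ i : Fin 2, (y' i).val / 2 = 0) then
        (star ψ ⬝ᵥ Matrix.mulVec (onSite x' (spinRaise 1) * onSite y' (spinLower 1)) ψ).re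
      else 0 := by
  have hK : ∀ x' y' : TorusSite 2 M, 0 < (star ψ ⬝ᵥ Matrix.mulVec
      (onSite x' (spinRaise 1) * onSite y' (spinLower 1)) ψ).re :=
    transverseKernelPos_allDelta M hEven h4 Δ ψ hψ hnorm heig
  have hterm : ∀ x' y' : TorusSite 2 M, 0 ≤ (if (∀ i : Fin 2, (x' i).val / 2 = ((![a, 0] : TorusSite 2 m) i).val) ∧
      (∀ i : Fin 2, (y' i).val / 2 = 0) then
        (star ψ ⬝ᵥ Matrix.mulVec (onSite x' (spinRaise 1) * onSite y' (spinLower 1)) ψ).re else 0) := by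
    intro x' y'
    split_ifs
    · exact (hK x' y').le
    · exact le_rfl
  set w : TorusSite 2 M := ![((2 * a.val : ℕ) : ZMod M), 0] with hw
  have haval : a.val < m := ZMod.val_lt a
  have hwit : (∀ i : Fin 2, (w i).val / 2 = ((![a, 0] : TorusSite 2 m) i).val) ∧
      (∀ i : Fin 2, ((0 : TorusSite 2 M) i).val / 2 = 0) := by
    refine ⟨fun i => ?_, fun i => by simp⟩
    fin_cases i
    · simp only [hw, Fin.zero_eta, Matrix.cons_val_zero]
      rw [ZMod.val_natCast, Nat.mod_eq_of_lt (by omega)]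
      omega
    · simp only [hw, Fin.mk_one, Matrix.cons_val_one, Matrix.cons_val_zero, ZMod.val_zero]
  have hdiag : 0 < (if (∀ i : Fin 2, (w i).val / 2 = ((![a, 0] : TorusSite 2 m) i).val) ∧
      (∀ i : Fin 2, ((0 : TorusSite 2 M) i).val / 2 = 0) then
        (star ψ ⬝ᵥ Matrix.mulVec (onSite w (spinRaise 1) * onSite 0 (spinLower 1)) ψ).re else 0) := by
    rw [if_pos hwit]
    exact hK w 0
  refine lt_of_lt_of_le hdiag (le_trans ?_ (Finset.single_le_sum
    (fun x' _ => Finset.sum_nonneg fun y' _ => hterm x' y') (Finset.mem_univ w)))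
  exact Finset.single_le_sum (fun y' _ => hterm w y') (Finset.mem_univ 0)

/-- A sequence whose logarithmic increments are non-decreasing on `{1, …, m-3}`: the increments are
monotone along the whole range, `d j ≤ d k` for `1 ≤ j ≤ k ≤ m - 2`. [folklore] -/
theorem incr_mono_of_succ {d : ℕ → ℝ} {m : ℕ} (hstep : ∀ j, 1 ≤ j → j + 3 ≤ m → d j ≤ d (j + 1))
    {j k : ℕ} (hj : 1 ≤ j) (hjk : j ≤ k) (hk : k + 2 ≤ m) : d j ≤ d k := by
  induction k with
  | zero => omega
  | succ k ih =>
    rcases Nat.eq_or_lt_of_le hjk with h | h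
    · rw [h]
    · exact (ih (by omega) (by omega)).trans (hstep k (by omega) (by omega))

/-- **Monotone decay of the 2×2-block kernel along a coarse axis (reflection positivity alone).**
For `M = 2m`, even `M ≥ 4`, `Δ ≤ 0` and every normalised `S^z_tot = 0` sector ground state `ψ` of
`H_M(Δ)`: `k₂(n+1, 0) ≤ k₂(n, 0)` whenever `1 ≤ n` and `n + 1 ≤ m/2` (log-convexity at the
centres `≥ 2`, `coarseKernel_axis_logConvex`; evenness `coarseKernel_neg`; positivity). [folklore] -/
theorem coarseKernel_axis_antitone (hM : M = 2 * m) (hEven : Even M) (h4 : 4 ≤ M) (Δ : ℝ)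
    (hΔ : Δ ≤ 0) (ψ : TensorIndex (TorusSite 2 M) 2 → ℂ)
    (hψ : ψ ∈ @spinZSector (TorusSite 2 M) _ _ 1 0) (hnorm : star ψ ⬝ᵥ ψ = 1)
    (heig : Matrix.mulVec (xxzHamiltonian 1 (torusGraph 2 M) (-1) Δ) ψ =
      ((lowestEnergyInSector 1 (xxzHamiltonian 1 (torusGraph 2 M) (-1) Δ) 0 : ℝ) : ℂ) • ψ)
    (n : ℕ) (hn1 : 1 ≤ n) (hnm : n + 1 ≤ m / 2) :
    (∑ x' : TorusSite 2 M, ∑ y' : TorusSite 2 M,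
      if (∀ i : Fin 2, (x' i).val / 2 = ((![((n + 1 : ℕ) : ZMod m), 0] : TorusSite 2 m) i).val) ∧
          (∀ i : Fin 2, (y' i).val / 2 = 0) then
        (star ψ ⬝ᵥ Matrix.mulVec (onSite x' (spinRaise 1) * onSite y' (spinLower 1)) ψ).re
      else 0) ≤
    (∑ x' : TorusSite 2 M, ∑ y' : TorusSite 2 M,
      if (∀ i : Fin 2, (x' i).val / 2 = ((![((n : ℕ) : ZMod m), 0] : TorusSite 2 m) i).val) ∧
          (∀ i : Fin 2, (y' i).val / 2 = 0) then
        (star ψ ⬝ᵥ Matrix.mulVec (onSite x' (spinRaise 1) * onSite y' (spinLower 1)) ψ).re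
      else 0) := by
  -- the axis sequence `a j = k₂(j, 0)`
  set a : ℕ → ℝ := fun j => ∑ x' : TorusSite 2 M, ∑ y' : TorusSite 2 M,
      if (∀ i : Fin 2, (x' i).val / 2 = ((![((j : ℕ) : ZMod m), 0] : TorusSite 2 m) i).val) ∧
          (∀ i : Fin 2, (y' i).val / 2 = 0) then
        (star ψ ⬝ᵥ Matrix.mulVec (onSite x' (spinRaise 1) * onSite y' (spinLower 1)) ψ).re
      else 0 with ha
  show a (n + 1) ≤ a n
  have hpos : ∀ j, 0 < a j := fun j =>
    coarseKernel_axis_pos_allDelta M hEven h4 Δ ψ hψ hnorm heig hM _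
  -- log-convexity at the centres `2 ≤ c ≤ m - 2`
  have hlc : ∀ c, 2 ≤ c → c + 2 ≤ m → a c ^ 2 ≤ a (c - 1) * a (c + 1) := fun c hc hcm =>
    coarseKernel_axis_logConvex M hM hEven h4 Δ hΔ ψ hψ hnorm heig c hc hcm
  -- evenness: `a (m - j) = a j` for `j ≤ m`
  have hsymm : ∀ j, j ≤ m → a (m - j) = a j := by
    intro j hj
    have h := coarseKernel_neg M hM hEven Δ ψ hψ hnorm heig (![((j : ℕ) : ZMod m), 0] : TorusSite 2 m)
    have hv : (-(![((j : ℕ) : ZMod m), 0] : TorusSite 2 m)) = ![(((m - j : ℕ)) : ZMod m), 0] := by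
      funext l
      fin_cases l
      · simp only [Fin.zero_eta, Pi.neg_apply, Matrix.cons_val_zero]
        rw [Nat.cast_sub hj, ZMod.natCast_self, zero_sub]
      · simp
    rw [hv] at h
    exact h
  -- logarithmic increments
  set d : ℕ → ℝ := fun j => Real.log (a (j + 1)) - Real.log (a j) with hd
  have hstep : ∀ j, 1 ≤ j → j + 3 ≤ m → d j ≤ d (j + 1) := by
    intro j hj hjm
    have h := hlc (j + 1) (by omega) (by omega)
    have h2 := Real.log_le_log (pow_pos (hpos _) 2) h
    rw [Real.log_pow, Real.log_mul (hpos _).ne' (hpos _).ne', Nat.add_sub_cancel] at h2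
    simp only [hd, Nat.cast_ofNat] at h2 ⊢
    have e : j + 1 + 1 = j + 2 := by omega
    rw [e]
    rw [show j + 1 + 1 = j + 2 from e] at h2
    linarith
  have hanti : ∀ j, 1 ≤ j → j + 1 ≤ m → d (m - 1 - j) = -d j := by
    intro j hj hjm
    simp only [hd]
    have e1 : m - 1 - j + 1 = m - j := by omega
    rw [e1, hsymm j (by omega), show m - 1 - j = m - (j + 1) by omega, hsymm (j + 1) hjm]
    ring
  -- `d n ≤ d (m - 1 - n) = - d n`
  have hchain : d n ≤ d (m - 1 - n) :=
    incr_mono_of_succ hstep hn1 (by omega) (by omega)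
  rw [hanti n hn1 (by omega)] at hchain
  have hdn : d n ≤ 0 := by linarith
  have hlog : Real.log (a (n + 1)) ≤ Real.log (a n) := by
    simp only [hd] at hdn
    linarith
  exact (Real.log_le_log_iff (hpos _) (hpos _)).1 hlog

/-- **Registered form** (sub-goal `coarseKernel_axis_antitone_all`). [folklore] -/
theorem coarseKernel_axis_antitone_all :
    ∀ (M m : ℕ) [NeZero M] [NeZero m], M = 2 * m → Even M → 4 ≤ M → ∀ (Δ : ℝ), Δ ≤ 0 → ∀ (ψ :
      TensorIndex (TorusSite 2 M) 2 → ℂ), ψ ∈ @spinZSector (TorusSite 2 M) _ _ 1 0 → star ψ ⬝ᵥ ψ = 1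
      → Matrix.mulVec (xxzHamiltonian 1 (torusGraph 2 M) (-1) Δ) ψ = ((lowestEnergyInSector 1
      (xxzHamiltonian 1 (torusGraph 2 M) (-1) Δ) 0 : ℝ) : ℂ) • ψ → ∀ (n : ℕ), 1 ≤ n → n + 1 ≤ m / 2
      → (∑ x' : TorusSite 2 M, ∑ y' : TorusSite 2 M, if (∀ i : Fin 2, (x' i).val / 2 = ((![((n + 1 :
      ℕ) : ZMod m), 0] : TorusSite 2 m) i).val) ∧ (∀ i : Fin 2, (y' i).val / 2 = 0) then (star ψ ⬝ᵥ
      Matrix.mulVec (onSite x' (spinRaise 1) * onSite y' (spinLower 1)) ψ).re else 0) ≤ (∑ x' :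
      TorusSite 2 M, ∑ y' : TorusSite 2 M, if (∀ i : Fin 2, (x' i).val / 2 = ((![((n : ℕ) : ZMod m),
      0] : TorusSite 2 m) i).val) ∧ (∀ i : Fin 2, (y' i).val / 2 = 0) then (star ψ ⬝ᵥ Matrix.mulVec
      (onSite x' (spinRaise 1) * onSite y' (spinLower 1)) ψ).re else 0) :=
  fun M _ _ _ hM hEven h4 Δ hΔ ψ hψ hnorm heig n hn1 hnm =>
    coarseKernel_axis_antitone M hM hEven h4 Δ hΔ ψ hψ hnorm heig n hn1 hnm

end Monotone

end Summit.HubbardSuperconductivity.HubbardSuperconductivity.Theorems.LevyLogBootstrap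

end
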